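import Mathlib.NumberTheory.NumberField.InfinitePlace.Ramification
import Mathlib.RingTheory.DedekindDomain.AdicValuation
import Mathlib.RingTheory.DedekindDomain.SelmerGroup
import Literature.NumberTheory.Automorphic.GaloisActionPlaces
import HarnessLib

/-!
# Places of isomorphic number fields: transport of finite and archimedean places along a ring isomorphism

Classical bookkeeping (J. W. S. Cassels, A. Fröhlich (eds.), *Algebraic Number Theory* (1967), Ch. VII
(J. Tate), §1.1 "Action of the Galois group on primes and completions": `|σ a|_{σ w} = |a|_w`; stated
there for automorphisms, the same one-line argument applies to an isomorphism `σ : K ⥲ K'` between two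
number fields). The tree's `Literature/NumberTheory/Automorphic/GaloisActionPlaces.lean` treats a GROUP
acting on ONE Dedekind domain / number field; this file treats a single ring ISOMORPHISM between two
(possibly different) Dedekind domains / number fields, which is the shape needed when isomorphic but
distinct copies of a number field are compared (e.g. the Frobenius-like and étale-like copies of `F_mod`
in [IUTchIII] §3 — consumer `Literature/IUT/LogThetaLattice/GlobalFrobenioidModelsTransport.lean`).

Contents (all PROVED, Mathlib-level statements; no number-theoretic input beyond Mathlib):
* `mapHeightOneSpectrum σ : HeightOneSpectrum R → HeightOneSpectrum S` for a ring isomorphism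
  `σ : R ≃+* S` (`𝔭 ↦ σ(𝔭)`), the bijection `heightOneSpectrumCongr σ`, and, for Dedekind domains,
  `intValuation_mapHeightOneSpectrum : v_{σ𝔭}(σ x) = v_𝔭(x)`;
* for number fields `σ : K ≃+* K'`: `finitePlaceEquiv σ : HeightOneSpectrum (𝓞 K) ≃ HeightOneSpectrum (𝓞 K')`
  with `valuation_finitePlaceEquiv : v_{σw}(σ x) = v_w(x)` on `K`, and
  `infinitePlaceEquiv σ : InfinitePlace K ≃ InfinitePlace K'` with `infinitePlaceEquiv_apply :
  |σ x|_{σw} = |x|_w`;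
* functoriality: `…_refl`, `…_trans` (transport along `σ` then `τ` is transport along `σ.trans τ`).
-/

namespace Literature.NumberTheory.NumberFields

open IsDedekindDomain NumberField
open Literature.NumberTheory.Automorphic (WithZero.eq_of_forall_le_exp_neg_iff)

/-! ### Nonzero primes along a ring isomorphism -/

section Primes

variable {R S T : Type*} [CommRing R] [CommRing S] [CommRing T]

/-- Transport of a nonzero prime along a ring isomorphism `σ : R ≃+* S`: `𝔭 ↦ σ(𝔭)` (Cassels–Fröhlich
VII §1.1, for an isomorphism instead of an automorphism). [cite: CasselsFrohlichANT1967, Ch. VII §1.1] -/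
def mapHeightOneSpectrum (σ : R ≃+* S) (v : HeightOneSpectrum R) : HeightOneSpectrum S where
  asIdeal := Ideal.map (σ : R →+* S) v.asIdeal
  isPrime := Ideal.map_isPrime_of_equiv σ
  ne_bot h := v.ne_bot <| by
    have h' := congrArg (Ideal.map (σ.symm : S →+* R)) h
    rwa [Ideal.map_of_equiv, Ideal.map_bot] at h'

/-- The prime of the transported place is `σ(𝔭)` (definitional).
[cite: CasselsFrohlichANT1967, Ch. VII §1.1] -/
@[simp] theorem mapHeightOneSpectrum_asIdeal (σ : R ≃+* S) (v : HeightOneSpectrum R) :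
    (mapHeightOneSpectrum σ v).asIdeal = Ideal.map (σ : R →+* S) v.asIdeal := rfl

/-- Transport along `σ` and then along `σ⁻¹` is the identity.
[cite: CasselsFrohlichANT1967, Ch. VII §1.1] -/
@[simp] theorem mapHeightOneSpectrum_symm_mapHeightOneSpectrum (σ : R ≃+* S)
    (v : HeightOneSpectrum R) : mapHeightOneSpectrum σ.symm (mapHeightOneSpectrum σ v) = v :=
  HeightOneSpectrum.ext (by simp)

/-- Transport along `σ⁻¹` and then along `σ` is the identity.
[cite: CasselsFrohlichANT1967, Ch. VII §1.1] -/
@[simp] theorem mapHeightOneSpectrum_mapHeightOneSpectrum_symm (σ : R ≃+* S)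
    (w : HeightOneSpectrum S) : mapHeightOneSpectrum σ (mapHeightOneSpectrum σ.symm w) = w := by
  simpa using mapHeightOneSpectrum_symm_mapHeightOneSpectrum σ.symm w

/-- Transport along the identity isomorphism is the identity.
[cite: CasselsFrohlichANT1967, Ch. VII §1.1] -/
@[simp] theorem mapHeightOneSpectrum_refl (v : HeightOneSpectrum R) :
    mapHeightOneSpectrum (RingEquiv.refl R) v = v :=
  HeightOneSpectrum.ext (by simp [Ideal.map_id])

/-- Transport along a composite is the composite of the transports.
[cite: CasselsFrohlichANT1967, Ch. VII §1.1] -/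
theorem mapHeightOneSpectrum_trans (σ : R ≃+* S) (τ : S ≃+* T) (v : HeightOneSpectrum R) :
    mapHeightOneSpectrum (σ.trans τ) v = mapHeightOneSpectrum τ (mapHeightOneSpectrum σ v) :=
  HeightOneSpectrum.ext (by
    simp only [mapHeightOneSpectrum_asIdeal, Ideal.map_map]
    rfl)

/-- The nonzero primes of isomorphic rings correspond bijectively along `σ`.
[cite: CasselsFrohlichANT1967, Ch. VII §1.1] -/
def heightOneSpectrumCongr (σ : R ≃+* S) : HeightOneSpectrum R ≃ HeightOneSpectrum S where
  toFun := mapHeightOneSpectrum σ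
  invFun := mapHeightOneSpectrum σ.symm
  left_inv := mapHeightOneSpectrum_symm_mapHeightOneSpectrum σ
  right_inv := mapHeightOneSpectrum_mapHeightOneSpectrum_symm σ

/-- `heightOneSpectrumCongr σ v = mapHeightOneSpectrum σ v` (definitional).
[cite: CasselsFrohlichANT1967, Ch. VII §1.1] -/
@[simp] theorem heightOneSpectrumCongr_apply (σ : R ≃+* S) (v : HeightOneSpectrum R) :
    heightOneSpectrumCongr σ v = mapHeightOneSpectrum σ v := rfl

/-- `(heightOneSpectrumCongr σ).symm = heightOneSpectrumCongr σ.symm` (definitional).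
[cite: CasselsFrohlichANT1967, Ch. VII §1.1] -/
@[simp] theorem heightOneSpectrumCongr_symm (σ : R ≃+* S) :
    (heightOneSpectrumCongr σ).symm = heightOneSpectrumCongr σ.symm := rfl

end Primes

section Dedekind

variable {R S : Type*} [CommRing R] [IsDedekindDomain R] [CommRing S] [IsDedekindDomain S]

/-- **`v_{σ𝔭}(σ x) = v_𝔭(x)`** on a Dedekind domain: the `𝔭`-adic valuation is transported along a ring
isomorphism (both sides are characterised by `v(x) ≤ exp(-n) ↔ x ∈ 𝔭ⁿ`, and `σ(𝔭ⁿ) = σ(𝔭)ⁿ`);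
Cassels–Fröhlich VII §1.1 `|σ a|_{σ w} = |a|_w`. [cite: CasselsFrohlichANT1967, Ch. VII §1.1] -/
theorem intValuation_mapHeightOneSpectrum (σ : R ≃+* S) (v : HeightOneSpectrum R) (x : R) :
    (mapHeightOneSpectrum σ v).intValuation (σ x) = v.intValuation x := by
  refine WithZero.eq_of_forall_le_exp_neg_iff (HeightOneSpectrum.intValuation_le_one _ _)
    (HeightOneSpectrum.intValuation_le_one _ _) fun n => ?_
  rw [HeightOneSpectrum.intValuation_le_pow_iff_mem, HeightOneSpectrum.intValuation_le_pow_iff_mem,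
    mapHeightOneSpectrum_asIdeal, ← Ideal.map_pow]
  exact Ideal.apply_mem_of_equiv_iff

end Dedekind

/-! ### Number fields: finite places along `σ : K ≃+* K'` -/

section NumberFieldFinite

variable {K K' K'' : Type*} [Field K] [Field K'] [Field K'']

/-- **Finite places of isomorphic number fields correspond**: `w ↦ σ(w)` along `σ : K ≃+* K'` (through
the induced isomorphism `𝓞 K ≃+* 𝓞 K'` of rings of integers). [cite: CasselsFrohlichANT1967, Ch. VII §1.1] -/
def finitePlaceEquiv (σ : K ≃+* K') : HeightOneSpectrum (𝓞 K) ≃ HeightOneSpectrum (𝓞 K') :=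
  heightOneSpectrumCongr (RingOfIntegers.mapRingEquiv σ)

/-- The prime of `σ(w)` is the image of the prime of `w` under `𝓞 K ≃+* 𝓞 K'` (definitional).
[cite: CasselsFrohlichANT1967, Ch. VII §1.1] -/
@[simp] theorem finitePlaceEquiv_asIdeal (σ : K ≃+* K') (w : HeightOneSpectrum (𝓞 K)) :
    (finitePlaceEquiv σ w).asIdeal =
      Ideal.map (RingOfIntegers.mapRingEquiv σ : 𝓞 K →+* 𝓞 K') w.asIdeal := rfl

/-- `finitePlaceEquiv σ w` is the Dedekind-level transport along `𝓞 K ≃+* 𝓞 K'` (definitional).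
[cite: CasselsFrohlichANT1967, Ch. VII §1.1] -/
theorem finitePlaceEquiv_apply (σ : K ≃+* K') (w : HeightOneSpectrum (𝓞 K)) :
    finitePlaceEquiv σ w = mapHeightOneSpectrum (RingOfIntegers.mapRingEquiv σ) w := rfl

/-- `(RingOfIntegers.mapRingEquiv σ).symm = RingOfIntegers.mapRingEquiv σ.symm`.
[cite: CasselsFrohlichANT1967, Ch. VII §1.1] -/
theorem RingOfIntegers.mapRingEquiv_symm (σ : K ≃+* K') :
    (RingOfIntegers.mapRingEquiv σ).symm = RingOfIntegers.mapRingEquiv σ.symm := rfl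

/-- `RingOfIntegers.mapRingEquiv` is compatible with composition.
[cite: CasselsFrohlichANT1967, Ch. VII §1.1] -/
theorem RingOfIntegers.mapRingEquiv_trans (σ : K ≃+* K') (τ : K' ≃+* K'') :
    RingOfIntegers.mapRingEquiv (σ.trans τ) =
      (RingOfIntegers.mapRingEquiv σ).trans (RingOfIntegers.mapRingEquiv τ) :=
  RingEquiv.ext fun _ => Subtype.ext rfl

/-- `RingOfIntegers.mapRingEquiv (refl) = refl`. [cite: CasselsFrohlichANT1967, Ch. VII §1.1] -/
theorem RingOfIntegers.mapRingEquiv_refl :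
    RingOfIntegers.mapRingEquiv (RingEquiv.refl K) = RingEquiv.refl (𝓞 K) :=
  RingEquiv.ext fun _ => Subtype.ext rfl

/-- The inverse correspondence is transport along `σ⁻¹`.
[cite: CasselsFrohlichANT1967, Ch. VII §1.1] -/
@[simp] theorem finitePlaceEquiv_symm (σ : K ≃+* K') :
    (finitePlaceEquiv σ).symm = finitePlaceEquiv σ.symm := rfl

/-- Transport of finite places along the identity is the identity.
[cite: CasselsFrohlichANT1967, Ch. VII §1.1] -/
@[simp] theorem finitePlaceEquiv_refl : finitePlaceEquiv (RingEquiv.refl K) = Equiv.refl _ := by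
  ext w : 1
  rw [finitePlaceEquiv_apply, RingOfIntegers.mapRingEquiv_refl, mapHeightOneSpectrum_refl]
  rfl

/-- Transport of finite places is compatible with composition of isomorphisms.
[cite: CasselsFrohlichANT1967, Ch. VII §1.1] -/
theorem finitePlaceEquiv_trans (σ : K ≃+* K') (τ : K' ≃+* K'') :
    finitePlaceEquiv (σ.trans τ) = (finitePlaceEquiv σ).trans (finitePlaceEquiv τ) := by
  ext w : 1
  rw [Equiv.trans_apply, finitePlaceEquiv_apply, finitePlaceEquiv_apply, finitePlaceEquiv_apply,
    RingOfIntegers.mapRingEquiv_trans, mapHeightOneSpectrum_trans]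

variable [NumberField K] [NumberField K']

/-- **`v_{σw}(σ x) = v_w(x)`** on the number field `K` (Cassels–Fröhlich VII §1.1 `|σ a|_{σ w} = |a|_w`):
the `w`-adic valuation is transported along `σ : K ≃+* K'`. [cite: CasselsFrohlichANT1967, Ch. VII §1.1] -/
theorem valuation_finitePlaceEquiv (σ : K ≃+* K') (w : HeightOneSpectrum (𝓞 K)) (x : K) :
    (finitePlaceEquiv σ w).valuation K' (σ x) = w.valuation K x := by
  obtain ⟨a, b, -, rfl⟩ := IsFractionRing.div_surjective (A := 𝓞 K) x
  have ha : σ (algebraMap (𝓞 K) K a) = algebraMap (𝓞 K') K' (RingOfIntegers.mapRingEquiv σ a) := rfl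
  have hb : σ (algebraMap (𝓞 K) K b) = algebraMap (𝓞 K') K' (RingOfIntegers.mapRingEquiv σ b) := rfl
  rw [map_div₀, map_div₀, map_div₀, ha, hb, HeightOneSpectrum.valuation_of_algebraMap,
    HeightOneSpectrum.valuation_of_algebraMap, HeightOneSpectrum.valuation_of_algebraMap,
    HeightOneSpectrum.valuation_of_algebraMap, finitePlaceEquiv_apply,
    intValuation_mapHeightOneSpectrum, intValuation_mapHeightOneSpectrum]

/-- The integer-valued valuation on units is transported likewise:
`ord_{σw}(σ f) = ord_w(f)` for `f ∈ K^×`. [cite: CasselsFrohlichANT1967, Ch. VII §1.1] -/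
theorem valuationOfNeZero_finitePlaceEquiv (σ : K ≃+* K') (w : HeightOneSpectrum (𝓞 K)) (f : Kˣ) :
    (finitePlaceEquiv σ w).valuationOfNeZero (K := K') (Units.map (σ : K →* K') f) =
      w.valuationOfNeZero (K := K) f := by
  rw [← WithZero.coe_inj, HeightOneSpectrum.valuationOfNeZero_eq,
    HeightOneSpectrum.valuationOfNeZero_eq, Units.coe_map]
  exact valuation_finitePlaceEquiv σ w f

end NumberFieldFinite

/-! ### Fields: archimedean places along `σ : K ≃+* K'` -/

section InfinitePlaces

variable {K K' K'' : Type*} [Field K] [Field K'] [Field K'']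

/-- **Archimedean places of isomorphic fields correspond**: `w ↦ w ∘ σ⁻¹` along `σ : K ≃+* K'`
(Mathlib `InfinitePlace.comap` along `σ⁻¹`, with inverse `comap` along `σ`).
[cite: CasselsFrohlichANT1967, Ch. VII §1.1] -/
def infinitePlaceEquiv (σ : K ≃+* K') : InfinitePlace K ≃ InfinitePlace K' where
  toFun w := w.comap (σ.symm : K' →+* K)
  invFun w' := w'.comap (σ : K →+* K')
  left_inv w := by
    change (w.comap (σ.symm : K' →+* K)).comap (σ : K →+* K') = w
    have h : (σ.symm : K' →+* K).comp (σ : K →+* K') = RingHom.id K :=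
      RingHom.ext fun x => σ.symm_apply_apply x
    rw [← InfinitePlace.comap_comp, h, InfinitePlace.comap_id]
  right_inv w' := by
    change (w'.comap (σ : K →+* K')).comap (σ.symm : K' →+* K) = w'
    have h : (σ : K →+* K').comp (σ.symm : K' →+* K) = RingHom.id K' :=
      RingHom.ext fun x => σ.apply_symm_apply x
    rw [← InfinitePlace.comap_comp, h, InfinitePlace.comap_id]

/-- **`|σ x|_{σw} = |x|_w`** at archimedean places. [cite: CasselsFrohlichANT1967, Ch. VII §1.1] -/
@[simp] theorem infinitePlaceEquiv_apply (σ : K ≃+* K') (w : InfinitePlace K) (x : K) :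
    infinitePlaceEquiv σ w (σ x) = w x := by
  simp [infinitePlaceEquiv]

/-- Evaluating the transported place: `|y|_{σw} = |σ⁻¹ y|_w`.
[cite: CasselsFrohlichANT1967, Ch. VII §1.1] -/
theorem infinitePlaceEquiv_apply' (σ : K ≃+* K') (w : InfinitePlace K) (y : K') :
    infinitePlaceEquiv σ w y = w (σ.symm y) := by
  simp [infinitePlaceEquiv]

/-- The inverse correspondence is transport along `σ⁻¹`.
[cite: CasselsFrohlichANT1967, Ch. VII §1.1] -/
@[simp] theorem infinitePlaceEquiv_symm (σ : K ≃+* K') :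
    (infinitePlaceEquiv σ).symm = infinitePlaceEquiv σ.symm := rfl

/-- Transport of archimedean places along the identity is the identity.
[cite: CasselsFrohlichANT1967, Ch. VII §1.1] -/
@[simp] theorem infinitePlaceEquiv_refl : infinitePlaceEquiv (RingEquiv.refl K) = Equiv.refl _ := by
  ext w : 1
  exact InfinitePlace.comap_id w

/-- Transport of archimedean places is compatible with composition of isomorphisms.
[cite: CasselsFrohlichANT1967, Ch. VII §1.1] -/
theorem infinitePlaceEquiv_trans (σ : K ≃+* K') (τ : K' ≃+* K'') :
    infinitePlaceEquiv (σ.trans τ) = (infinitePlaceEquiv σ).trans (infinitePlaceEquiv τ) := by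
  ext w : 1
  change w.comap _ = (w.comap _).comap _
  rw [← InfinitePlace.comap_comp]
  rfl

/-- Real places go to real places, complex ones to complex ones.
[cite: CasselsFrohlichANT1967, Ch. VII §1.1] -/
theorem isReal_infinitePlaceEquiv_iff (σ : K ≃+* K') (w : InfinitePlace K) :
    (infinitePlaceEquiv σ w).IsReal ↔ w.IsReal := by
  constructor
  · intro h
    have h' := h.comap (σ : K →+* K')
    rwa [show (infinitePlaceEquiv σ w).comap (σ : K →+* K') = w from
      (infinitePlaceEquiv σ).left_inv w] at h'
  · intro h
    exact h.comap _

end InfinitePlaces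

end Literature.NumberTheory.NumberFields
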